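import Summits.QuantumFields.QCD.Theses.SpectralDefectExtinction
import Summits.QuantumFields.QCD.Theorems.ExtinctionBuildsQCD.Negative.WithoutTightCollapse
import Literature.MathematicalPhysics.QuantumFieldTheory.LatticeGaugeProofs

/-!
# Stub `stub_implantCost` (S2) of crux `WindowExtinction` (stmt-QuantumFields-8964)

Line `free-volume-heavy-witness`: the **finite-energy input** of the end-game.  Overwriting the
`SU(3)` link variables based in the image of ONE box `c + {-R,…,R}⁴` of the four-torus of side `n`
(`U' = U` off that edge set) changes

* (a) the Wilson action by at most `A`, and
* (b) `log ∏_f |det D_W(U, μ_f, 1)|` by at most `B`,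

with `A`, `B` depending only on `(N_f, R, lo)` — uniformly in the torus side `n`, the centre `c`,
the environment `U` and the new content `U'` (masses `μ_f ≥ lo > 0`).

## Proof

* (a) The Wilson action splits into the part carried by the plaquettes based in the shadow of the
  modified edge set and a bulk part that does not see the modified links (tree
  `wilsonAction_eq_shadowAction_add_bulkAction`, `bulkAction_congr`); the shadow part is bounded by
  `6 ·` (number of shadow plaquettes) (tree `abs_shadowAction_le`, `|Re tr V| ≤ 3` on `SU(3)`), and
  the shadow has at most `5 · 4 · (2R+1)⁴` sites.
* (b) For one flavour of mass `m ≥ lo > 0` put `D = D_W(U,m,1)`, `D' = D_W(U',m,1)`.  The Neumann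
  (hopping) series gives `det D ≠ 0` and `‖D⁻¹‖ ≤ 1/m` (tree `norm_one_sub_smul_wilsonDirac_le`),
  and `‖D' − D‖ ≤ 8` (four hopping isometries each, tree `l2_opNorm_wilsonHop_le`).  The `(p,q)`
  entry of `D_W(U)` reads only the links `U(p₁, μ)` (when `q₁ = p₁ + μ̂`) and `U(q₁, μ)` (when
  `p₁ = q₁ + μ̂`), so the COLUMNS of `E = D' − D`, hence of `K = D⁻¹ E`, are supported on the sites
  `T = S ∪ (S + μ̂)` (`S` the image of the box) times colour × spin.  Thus `1 + K` is block
  triangular for the partition `(T, Tᶜ)` with identity `Tᶜ`-block, `det D' = det D · det (1 + K)|_T`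
  (`Matrix.twoBlockTriangular_det'`), and the crude permutation bound with entries
  `≤ 1 + 8/m ≤ 1 + 8/lo` gives `|det D'| ≤ k! (1 + 8/lo)^k |det D|`, `k = 12 |T| ≤ 60 (2R+1)⁴`.
  The situation is symmetric in `(U, U')`, whence the two-sided bound on the logarithms, summed
  over the `N_f` flavours.

References: E. Seiler, LNP 159 (1982), Ch. 1 and Ch. 3 (bounded local plaquette terms; Wilson
fermions); I. Montvay, G. Münster, *Quantum Fields on a Lattice* (CUP 1994) §4.1, §5.1 (hopping
parameter expansion); standard finite-rank perturbation theory of determinants.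
-/

noncomputable section

namespace Summit.QuantumFields.QCD.Cruxes.WindowExtinction.FreeVolumeHeavyWitness

open Literature.MathematicalPhysics.QuantumLattice Literature.MathematicalPhysics.QuantumFieldTheory
  Literature.Probability.LatticeModels
open MeasureTheory Matrix Filter
open scoped BigOperators

/-! ## (a) The Wilson action under a local modification -/

/-- `|Re tr V| ≤ 3` for `V ∈ SU(3)` (entries of a unitary matrix have modulus `≤ 1`). -/
private theorem abs_trace_re_fundamentalRep_le (g : SU3) :
    |((fundamentalRep (Fin 3)) g).trace.re| ≤ 3 := by
  have hu := fundamentalRep_mem_unitaryGroup g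
  calc |((fundamentalRep (Fin 3)) g).trace.re| ≤ ‖((fundamentalRep (Fin 3)) g).trace‖ :=
        Complex.abs_re_le_norm _
    _ = ‖∑ k, (fundamentalRep (Fin 3)) g k k‖ := rfl
    _ ≤ ∑ k, ‖(fundamentalRep (Fin 3)) g k k‖ := norm_sum_le _ _
    _ ≤ ∑ _k : Fin 3, (1 : ℝ) :=
        Finset.sum_le_sum fun k _ => entry_norm_bound_of_unitary hu k k
    _ = 3 := by simp

/-- Overwriting the links of an edge set `S'` moves the `SU(3)` Wilson action by at most
`2 · 6 ·` (a bound on the number of plaquettes based in the shadow of `S'`). -/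
private theorem abs_wilsonAction_sub_le {n : ℕ} [NeZero n] (S' : Finset (Edge 4 n))
    (U U' : GaugeConfig 4 n SU3) (h : ∀ e, e ∉ S' → U' e = U e) :
    |wilsonAction (fundamentalRep (Fin 3)) U' - wilsonAction (fundamentalRep (Fin 3)) U| ≤
      2 * ((S'.card * 5 * 16 : ℕ) : ℝ) * 6 := by
  have hsh : ∀ V : GaugeConfig 4 n SU3,
      |shadowAction (fundamentalRep (Fin 3)) (edgeShadow S') V| ≤ ((S'.card * 5 * 16 : ℕ) : ℝ) * 6 := by
    intro V
    refine (abs_shadowAction_le (fundamentalRep (Fin 3)) abs_trace_re_fundamentalRep_le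
      (edgeShadow S') V).trans ?_
    have h1 : (edgeShadow S').card ≤ S'.card * 5 := card_edgeShadow_le S'
    have h2 : Fintype.card {q : Fin 4 × Fin 4 // q.1 < q.2} ≤ 16 :=
      (Fintype.card_subtype_le _).trans (by simp)
    have h3 : (((edgeShadow S').card * Fintype.card {q : Fin 4 × Fin 4 // q.1 < q.2} : ℕ) : ℝ) ≤
        ((S'.card * 5 * 16 : ℕ) : ℝ) := by
      exact_mod_cast Nat.mul_le_mul h1 h2
    have h6 : ((3 : ℕ) : ℝ) + 3 = 6 := by norm_num
    rw [h6]
    exact mul_le_mul_of_nonneg_right h3 (by norm_num)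
  rw [wilsonAction_eq_shadowAction_add_bulkAction (fundamentalRep (Fin 3)) (edgeShadow S') U',
    wilsonAction_eq_shadowAction_add_bulkAction (fundamentalRep (Fin 3)) (edgeShadow S') U,
    bulkAction_congr (fundamentalRep (Fin 3)) h, add_sub_add_right_eq_sub]
  have hU := hsh U
  have hU' := hsh U'
  rw [abs_le] at hU hU' ⊢
  constructor <;> linarith [hU.1, hU.2, hU'.1, hU'.2]

/-! ## (b) The fermion determinant under a local modification -/

/-- The `(p,q)` entry of the Wilson–Dirac matrix reads only the links `U(p₁, μ)` with
`q₁ = p₁ + μ̂` and `U(q₁, μ)` with `p₁ = q₁ + μ̂`. -/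
private theorem wilsonDirac_apply_congr {L N : ℕ} {G : Type*} [Group G]
    (ρ : G →* Matrix (Fin N) (Fin N) ℂ) {U U' : GaugeConfig 4 L G} (m r : ℝ)
    {p q : TorusSite 4 L × Fin N × Fin 4}
    (h1 : ∀ μ, q.1 = Literature.MathematicalPhysics.QuantumFieldTheory.Site.shift p.1 μ →
      U' (p.1, μ) = U (p.1, μ))
    (h2 : ∀ μ, p.1 = Literature.MathematicalPhysics.QuantumFieldTheory.Site.shift q.1 μ →
      U' (q.1, μ) = U (q.1, μ)) :
    wilsonDirac ρ U' m r p q = wilsonDirac ρ U m r p q := by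
  simp only [wilsonDirac, Matrix.of_apply]
  congr 1
  congr 1
  refine Finset.sum_congr rfl fun μ _ => ?_
  congr 1
  · split_ifs with h
    · rw [h1 μ h]
    · rfl
  · split_ifs with h
    · rw [h2 μ h]
    · rfl

/-- Column support of `D_W(U') − D_W(U)`: if every modified link `e` has `e₁ ∈ T` and
`e₁ + ν̂ ∈ T` for all `ν`, then the columns indexed by sites outside `T` agree. -/
private theorem wilsonDirac_apply_eq_of_not_mem {L : ℕ} (T : Finset (TorusSite 4 L))
    {U U' : GaugeConfig 4 L SU3}
    (hT : ∀ e : Edge 4 L, U' e ≠ U e → e.1 ∈ T ∧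
      ∀ ν, Literature.MathematicalPhysics.QuantumFieldTheory.Site.shift e.1 ν ∈ T)
    (m : ℝ) {p q : TorusSite 4 L × Fin 3 × Fin 4} (hq : q.1 ∉ T) :
    wilsonDirac (fundamentalRep (Fin 3)) U' m 1 p q = wilsonDirac (fundamentalRep (Fin 3)) U m 1 p q := by
  refine wilsonDirac_apply_congr (fundamentalRep (Fin 3)) m 1 (fun μ hμ => ?_) (fun μ _ => ?_)
  · by_contra h
    exact hq (hμ ▸ (hT (p.1, μ) h).2 μ)
  · by_contra h
    exact hq (hT (q.1, μ) h).1

open scoped Matrix.Norms.L2Operator in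
/-- **Heavy-mass invertibility with an operator-norm bound**: for `m > 0`, `det D_W(U,m,1) ≠ 0`
and `‖D_W(U,m,1)⁻¹‖ ≤ 1/m` in the `ℓ²` operator norm (Neumann series `D = (m+4)(1 − x)`,
`‖x‖ ≤ 4/(m+4)`; adapted from the tree's `norm_inv_wilsonDirac_apply_le`). -/
private theorem norm_inv_wilsonDirac_le {L : ℕ} [NeZero L] (U : GaugeConfig 4 L SU3) {m : ℝ}
    (hm : 0 < m) :
    (wilsonDirac (fundamentalRep (Fin 3)) U m 1).det ≠ 0 ∧
      ‖(wilsonDirac (fundamentalRep (Fin 3)) U m 1)⁻¹‖ ≤ m⁻¹ := by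
  -- adapted from `Literature.MathematicalPhysics.QuantumLattice.norm_inv_wilsonDirac_apply_le`
  have hρ : ∀ g : SU3, fundamentalRep (Fin 3) g ∈ Matrix.unitaryGroup (Fin 3) ℂ :=
    fundamentalRep_mem_unitaryGroup
  set c : ℝ := m + 4 with hcdef
  have hc : 0 < c := by rw [hcdef]; linarith
  set θ : ℝ := 4 / c with hθ
  have hθ1 : θ < 1 := by rw [hθ, div_lt_one hc, hcdef]; linarith
  set x : Matrix (TorusSite 4 L × Fin 3 × Fin 4) (TorusSite 4 L × Fin 3 × Fin 4) ℂ :=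
    1 - ((c : ℝ) : ℂ)⁻¹ • wilsonDirac (fundamentalRep (Fin 3)) U m 1 with hx
  have hxn : ‖x‖ ≤ θ := norm_one_sub_smul_wilsonDirac_le (fundamentalRep (Fin 3)) hρ U m hc
  have hxn1 : ‖x‖ < 1 := hxn.trans_lt hθ1
  set S : Matrix (TorusSite 4 L × Fin 3 × Fin 4) (TorusSite 4 L × Fin 3 × Fin 4) ℂ := ∑' k, x ^ k
    with hSdef
  have hS1 : (1 - x) * S = 1 := mul_neg_geom_series x hxn1
  have hc' : ((c : ℝ) : ℂ) ≠ 0 := by exact_mod_cast hc.ne'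
  have hD : wilsonDirac (fundamentalRep (Fin 3)) U m 1 = ((c : ℝ) : ℂ) • (1 - x) := by
    rw [hx, sub_sub_cancel, smul_smul, mul_inv_cancel₀ hc', one_smul]
  have hinv : wilsonDirac (fundamentalRep (Fin 3)) U m 1 * (((c : ℝ) : ℂ)⁻¹ • S) = 1 := by
    rw [hD, smul_mul_smul_comm, mul_inv_cancel₀ hc', one_smul, hS1]
  have hdet : (wilsonDirac (fundamentalRep (Fin 3)) U m 1).det ≠ 0 := by
    intro h0
    have := congrArg Matrix.det hinv
    rw [Matrix.det_mul, h0, zero_mul, Matrix.det_one] at this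
    exact zero_ne_one this
  refine ⟨hdet, ?_⟩
  have hSnorm : ‖S‖ ≤ (1 - θ)⁻¹ := by
    refine (tsum_geometric_le_of_norm_lt_one x hxn1).trans ?_
    have h1 := l2_opNorm_torusFermion_one_le (L := L) (N := 3)
    have h2 : (1 - ‖x‖)⁻¹ ≤ (1 - θ)⁻¹ := by
      apply inv_anti₀ (by linarith) (by linarith)
    linarith
  rw [Matrix.inv_eq_right_inv hinv, norm_smul, norm_inv, Complex.norm_real, Real.norm_eq_abs,
    abs_of_pos hc, ← heavy_prefactor_eq hm]
  exact mul_le_mul_of_nonneg_left hSnorm (inv_nonneg.2 hc.le)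

open scoped Matrix.Norms.L2Operator in
/-- `‖D_W(U') − D_W(U)‖ ≤ 8`: the mass terms cancel and each operator carries four hopping
isometries (tree `wilsonDirac_eq_sub_sum_wilsonHop`, `l2_opNorm_wilsonHop_le`). -/
private theorem norm_wilsonDirac_sub_le {L : ℕ} [NeZero L] (U U' : GaugeConfig 4 L SU3) (m : ℝ) :
    ‖wilsonDirac (fundamentalRep (Fin 3)) U' m 1 - wilsonDirac (fundamentalRep (Fin 3)) U m 1‖ ≤ 8 := by
  have hρ : ∀ g : SU3, fundamentalRep (Fin 3) g ∈ Matrix.unitaryGroup (Fin 3) ℂ :=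
    fundamentalRep_mem_unitaryGroup
  have h4 : ∀ V : GaugeConfig 4 L SU3, ‖∑ μ, wilsonHop (fundamentalRep (Fin 3)) V μ‖ ≤ 4 := fun V =>
    calc ‖∑ μ, wilsonHop (fundamentalRep (Fin 3)) V μ‖
        ≤ ∑ μ, ‖wilsonHop (fundamentalRep (Fin 3)) V μ‖ := norm_sum_le _ _
      _ ≤ ∑ _μ : Fin 4, (1 : ℝ) :=
          Finset.sum_le_sum fun μ _ => l2_opNorm_wilsonHop_le (fundamentalRep (Fin 3)) hρ V μ
      _ = 4 := by simp
  rw [wilsonDirac_eq_sub_sum_wilsonHop (fundamentalRep (Fin 3)) hρ U' m,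
    wilsonDirac_eq_sub_sum_wilsonHop (fundamentalRep (Fin 3)) hρ U m, sub_sub_sub_cancel_left]
  exact (norm_sub_le _ _).trans (by linarith [h4 U, h4 U'])

/-- The crude permutation bound `‖det M‖ ≤ k! x^k` for a `k × k` complex matrix with entries of
modulus `≤ x` (as Mathlib's `Matrix.det_le`). -/
private theorem norm_det_le_of_forall_norm_le {ι : Type*} [Fintype ι] [DecidableEq ι]
    {M : Matrix ι ι ℂ} {x : ℝ} (h : ∀ i j, ‖M i j‖ ≤ x) :
    ‖M.det‖ ≤ (Fintype.card ι).factorial * x ^ Fintype.card ι := by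
  rw [Matrix.det_apply]
  calc ‖∑ σ : Equiv.Perm ι, Equiv.Perm.sign σ • ∏ i, M (σ i) i‖
      ≤ ∑ σ : Equiv.Perm ι, ‖Equiv.Perm.sign σ • ∏ i, M (σ i) i‖ := norm_sum_le _ _
    _ ≤ ∑ _σ : Equiv.Perm ι, x ^ Fintype.card ι := by
        refine Finset.sum_le_sum fun σ _ => ?_
        have h1 : ‖Equiv.Perm.sign σ • ∏ i, M (σ i) i‖ = ‖∏ i, M (σ i) i‖ := by
          rcases Int.units_eq_one_or (Equiv.Perm.sign σ) with hs | hs <;> simp [hs]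
        rw [h1, norm_prod]
        calc ∏ i, ‖M (σ i) i‖ ≤ ∏ _i : ι, x :=
              Finset.prod_le_prod (fun i _ => norm_nonneg _) fun i _ => h _ _
          _ = x ^ Fintype.card ι := by rw [Finset.prod_const, Finset.card_univ]
    _ = (Fintype.card ι).factorial * x ^ Fintype.card ι := by
        rw [Finset.sum_const, Finset.card_univ, Fintype.card_perm, nsmul_eq_mul]

open scoped Matrix.Norms.L2Operator in
/-- **One-sided determinant comparison.**  If every modified link `e` has `e₁, e₁ + ν̂ ∈ T`, then
for `m > 0`, `12 |T| ≤ K` and `1 + 8/m ≤ x`: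
`|det D_W(U',m,1)| ≤ K! x^K |det D_W(U,m,1)|` — via `det D' = det D · det(1 + D⁻¹(D' − D))`, the
block-triangular structure of `1 + D⁻¹(D' − D)` (columns supported on `T`), and the permutation
bound on the `T`-block whose entries are `≤ 1 + ‖D⁻¹‖ ‖D' − D‖ ≤ 1 + 8/m`. -/
private theorem norm_det_le_of_agree {L : ℕ} [NeZero L] (T : Finset (TorusSite 4 L))
    {U U' : GaugeConfig 4 L SU3}
    (hT : ∀ e : Edge 4 L, U' e ≠ U e → e.1 ∈ T ∧
      ∀ ν, Literature.MathematicalPhysics.QuantumFieldTheory.Site.shift e.1 ν ∈ T)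
    {m : ℝ} (hm : 0 < m) {K : ℕ} (hK : T.card * 12 ≤ K) {x : ℝ} (hx : 1 + 8 * m⁻¹ ≤ x) :
    ‖(wilsonDirac (fundamentalRep (Fin 3)) U' m 1).det‖ ≤
      ((K.factorial : ℝ) * x ^ K) * ‖(wilsonDirac (fundamentalRep (Fin 3)) U m 1).det‖ := by
  obtain ⟨hdet, hinvn⟩ := norm_inv_wilsonDirac_le U hm
  set D := wilsonDirac (fundamentalRep (Fin 3)) U m 1 with hDdef
  set D' := wilsonDirac (fundamentalRep (Fin 3)) U' m 1 with hD'def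
  set Kmat := D⁻¹ * (D' - D) with hKmat
  have hDD' : D * (1 + Kmat) = D' := by
    rw [hKmat, mul_add, mul_one, ← mul_assoc, Matrix.mul_nonsing_inv D (isUnit_iff_ne_zero.2 hdet),
      one_mul, add_sub_cancel]
  -- columns of `Kmat` outside `T` vanish
  have hcol : ∀ p q : TorusSite 4 L × Fin 3 × Fin 4, q.1 ∉ T → Kmat p q = 0 := by
    intro p q hq
    rw [hKmat, Matrix.mul_apply]
    refine Finset.sum_eq_zero fun r _ => ?_
    rw [Matrix.sub_apply, hD'def, hDdef, wilsonDirac_apply_eq_of_not_mem T hT m hq, sub_self,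
      mul_zero]
  -- block-triangular reduction to the `T`-block
  set P : TorusSite 4 L × Fin 3 × Fin 4 → Prop := fun i => i.1 ∈ T with hP
  have hblock := Matrix.twoBlockTriangular_det' (1 + Kmat) P fun i hi j hj => by
    have hij : i ≠ j := fun h => hj (h ▸ hi)
    rw [Matrix.add_apply, Matrix.one_apply_ne hij, hcol i j hj, add_zero]
  have hId : Matrix.toSquareBlockProp (1 + Kmat) (fun i => ¬P i) = 1 := by
    ext i j
    rw [Matrix.toSquareBlockProp_def, Matrix.of_apply, Matrix.add_apply, hcol _ _ j.2, add_zero,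
      Matrix.one_apply, Matrix.one_apply]
    simp only [Subtype.ext_iff]
  rw [hId, Matrix.det_one, mul_one] at hblock
  -- size of the `T`-block
  have hk : Fintype.card {a // P a} ≤ K := by
    rw [Fintype.card_subtype]
    have hTS : Finset.univ.filter (fun a : TorusSite 4 L × Fin 3 × Fin 4 => P a) =
        T ×ˢ (Finset.univ : Finset (Fin 3 × Fin 4)) := by
      ext a
      simp [hP]
    rw [hTS, Finset.card_product, Finset.card_univ, Fintype.card_prod, Fintype.card_fin,
      Fintype.card_fin]
    exact hK
  -- entries of the `T`-block
  have hKn : ‖Kmat‖ ≤ 8 * m⁻¹ := by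
    rw [hKmat]
    refine (norm_mul_le _ _).trans ?_
    have hE := norm_wilsonDirac_sub_le U U' m
    rw [mul_comm]
    exact mul_le_mul hE hinvn (norm_nonneg _) (by norm_num)
  have hx1 : 1 ≤ x := le_trans (by have := inv_nonneg.2 hm.le; linarith) hx
  have hent : ∀ i j, ‖Matrix.toSquareBlockProp (1 + Kmat) P i j‖ ≤ x := by
    intro i j
    rw [Matrix.toSquareBlockProp_def, Matrix.of_apply, Matrix.add_apply]
    refine (norm_add_le _ _).trans (le_trans ?_ hx)
    refine add_le_add ?_ ((Literature.MathematicalPhysics.QuantumLattice.norm_apply_le_l2_opNorm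
      Kmat _ _).trans hKn)
    rw [Matrix.one_apply]
    split_ifs <;> simp
  have hdetB : ‖(Matrix.toSquareBlockProp (1 + Kmat) P).det‖ ≤ (K.factorial : ℝ) * x ^ K := by
    refine (norm_det_le_of_forall_norm_le hent).trans ?_
    have h1 : ((Fintype.card {a // P a}).factorial : ℝ) ≤ K.factorial := by
      exact_mod_cast Nat.factorial_le hk
    have h2 : x ^ Fintype.card {a // P a} ≤ x ^ K := pow_le_pow_right₀ hx1 hk
    exact mul_le_mul h1 h2 (by positivity) (by positivity)
  calc ‖D'.det‖ = ‖D.det‖ * ‖(1 + Kmat).det‖ := by rw [← hDD', Matrix.det_mul, norm_mul]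
    _ = ‖D.det‖ * ‖(Matrix.toSquareBlockProp (1 + Kmat) P).det‖ := by rw [hblock]
    _ ≤ ‖D.det‖ * ((K.factorial : ℝ) * x ^ K) :=
        mul_le_mul_of_nonneg_left hdetB (norm_nonneg _)
    _ = _ := mul_comm _ _

/-- `|log a − log b| ≤ log C` from `a ≤ C b`, `b ≤ C a` (`a, b > 0`). -/
private theorem abs_log_sub_log_le {a b C : ℝ} (ha : 0 < a) (hb : 0 < b) (h1 : a ≤ C * b)
    (h2 : b ≤ C * a) : |Real.log a - Real.log b| ≤ Real.log C := by
  have hC : 0 < C := by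
    by_contra h
    push Not at h
    have : C * b ≤ 0 := mul_nonpos_of_nonpos_of_nonneg h hb.le
    linarith
  rw [abs_sub_le_iff]
  constructor
  · have := Real.log_le_log ha h1
    rw [Real.log_mul hC.ne' hb.ne'] at this
    linarith
  · have := Real.log_le_log hb h2
    rw [Real.log_mul hC.ne' ha.ne'] at this
    linarith

/-- **Per-flavour two-sided bound**: `|log|det D_W(U',m,1)| − log|det D_W(U,m,1)|| ≤ log (K! (1+8/lo)^K)`
for `m ≥ lo > 0` and `12 |T| ≤ K`, `T` as in `norm_det_le_of_agree`. -/
private theorem abs_log_det_sub_le {L : ℕ} [NeZero L] (T : Finset (TorusSite 4 L))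
    {U U' : GaugeConfig 4 L SU3}
    (hT : ∀ e : Edge 4 L, U' e ≠ U e → e.1 ∈ T ∧
      ∀ ν, Literature.MathematicalPhysics.QuantumFieldTheory.Site.shift e.1 ν ∈ T)
    {lo m : ℝ} (hlo : 0 < lo) (hm : lo ≤ m) {K : ℕ} (hK : T.card * 12 ≤ K) :
    |Real.log ‖(wilsonDirac (fundamentalRep (Fin 3)) U' m 1).det‖ -
        Real.log ‖(wilsonDirac (fundamentalRep (Fin 3)) U m 1).det‖| ≤
      Real.log ((K.factorial : ℝ) * (1 + 8 * lo⁻¹) ^ K) := by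
  have hm0 : 0 < m := hlo.trans_le hm
  have hx : 1 + 8 * m⁻¹ ≤ 1 + 8 * lo⁻¹ := by
    have := inv_anti₀ hlo hm
    linarith
  have hT' : ∀ e : Edge 4 L, U e ≠ U' e → e.1 ∈ T ∧
      ∀ ν, Literature.MathematicalPhysics.QuantumFieldTheory.Site.shift e.1 ν ∈ T :=
    fun e he => hT e (Ne.symm he)
  have h1 := norm_det_le_of_agree T hT hm0 hK hx
  have h2 := norm_det_le_of_agree T hT' hm0 hK hx
  have ha : 0 < ‖(wilsonDirac (fundamentalRep (Fin 3)) U' m 1).det‖ :=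
    norm_pos_iff.2 (norm_inv_wilsonDirac_le U' hm0).1
  have hb : 0 < ‖(wilsonDirac (fundamentalRep (Fin 3)) U m 1).det‖ :=
    norm_pos_iff.2 (norm_inv_wilsonDirac_le U hm0).1
  exact abs_log_sub_log_le ha hb h1 h2

/-! ## The stub -/

/-- **STUB S2** (`= ImplantCostBound`): overwriting the links based in the image of one box
`c + {-R,…,R}⁴` changes the Wilson action by at most `A = 3840 (2R+1)⁴` and
`log ∏_f |det D_W(·, μ_f, 1)|` by at most `B = N_f · log (k! (1 + 8/lo)^k)`, `k = 60 (2R+1)⁴`,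
uniformly in the torus, the centre, the environment and the new content. -/
theorem stub_implantCost :
    ∀ (Nf R : ℕ) (lo hi : ℝ), 0 < lo → lo ≤ hi → ∃ A B : ℝ,
      ∀ (n : ℕ) [NeZero n], 2 * R + 1 < n → ∀ (c : Fin 4 → ℤ) (μ : Fin Nf → ℝ),
        (∀ f, lo ≤ μ f ∧ μ f ≤ hi) → ∀ (U U' : GaugeConfig 4 n SU3),
          (∀ e, (¬ ∃ y : ↥(box 4 R), Torus.proj n (c + (y : Fin 4 → ℤ)) = e.1) → U' e = U e) →
          |wilsonAction (fundamentalRep (Fin 3)) U' - wilsonAction (fundamentalRep (Fin 3)) U| ≤ A ∧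
            |Real.log (∏ f : Fin Nf, ‖fermionDet (wilsonDirac (fundamentalRep (Fin 3)) U' (μ f) 1)‖) -
                Real.log (∏ f : Fin Nf, ‖fermionDet (wilsonDirac (fundamentalRep (Fin 3)) U (μ f) 1)‖)| ≤
              B := by
  intro Nf R lo hi hlo _hlohi
  refine ⟨2 * ((((2 * R + 1) ^ 4 * 4) * 5 * 16 : ℕ) : ℝ) * 6,
    Nf * Real.log (((60 * (2 * R + 1) ^ 4).factorial : ℝ) *
      (1 + 8 * lo⁻¹) ^ (60 * (2 * R + 1) ^ 4)), ?_⟩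
  intro n _ _hn c μ hμ U U' hUU'
  -- the image `S` of the box in the torus; `U' = U` off the edges based in `S`
  set S : Finset (TorusSite 4 n) := (box 4 R).image fun y => Torus.proj n (c + y) with hS
  have hScard : S.card ≤ (2 * R + 1) ^ 4 := Finset.card_image_le.trans (card_box 4 R).le
  have hagree : ∀ e : Edge 4 n, e.1 ∉ S → U' e = U e := fun e he =>
    hUU' e fun ⟨y, hy⟩ => he (Finset.mem_image.2 ⟨(y : Fin 4 → ℤ), y.2, hy⟩)
  constructor
  · -- (a) the Wilson action
    have hS' : ∀ e : Edge 4 n, e ∉ S ×ˢ (Finset.univ : Finset (Fin 4)) → U' e = U e :=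
      fun e he => hagree e fun h1 => he (Finset.mem_product.2 ⟨h1, Finset.mem_univ _⟩)
    refine (abs_wilsonAction_sub_le _ U U' hS').trans ?_
    have hc : (S ×ˢ (Finset.univ : Finset (Fin 4))).card ≤ (2 * R + 1) ^ 4 * 4 := by
      rw [Finset.card_product, Finset.card_univ, Fintype.card_fin]
      exact Nat.mul_le_mul_right 4 hScard
    have hc' : (((S ×ˢ (Finset.univ : Finset (Fin 4))).card * 5 * 16 : ℕ) : ℝ) ≤
        ((((2 * R + 1) ^ 4 * 4) * 5 * 16 : ℕ) : ℝ) := by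
      exact_mod_cast Nat.mul_le_mul_right 16 (Nat.mul_le_mul_right 5 hc)
    linarith
  · -- (b) the determinant weights
    set T : Finset (TorusSite 4 n) := S ∪ (S ×ˢ (Finset.univ : Finset (Fin 4))).image
      fun a => Literature.MathematicalPhysics.QuantumFieldTheory.Site.shift a.1 a.2 with hT
    have hTcard : T.card * 12 ≤ 60 * (2 * R + 1) ^ 4 := by
      have h1 : T.card ≤ S.card + S.card * 4 :=
        (Finset.card_union_le _ _).trans (add_le_add le_rfl (Finset.card_image_le.trans
          (by rw [Finset.card_product, Finset.card_univ, Fintype.card_fin])))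
      calc T.card * 12 ≤ (S.card + S.card * 4) * 12 := Nat.mul_le_mul_right 12 h1
        _ = 60 * S.card := by ring
        _ ≤ 60 * (2 * R + 1) ^ 4 := Nat.mul_le_mul_left 60 hScard
    have hTmem : ∀ e : Edge 4 n, U' e ≠ U e → e.1 ∈ T ∧
        ∀ ν, Literature.MathematicalPhysics.QuantumFieldTheory.Site.shift e.1 ν ∈ T := by
      intro e he
      have h1 : e.1 ∈ S := by
        by_contra h
        exact he (hagree e h)
      exact ⟨Finset.mem_union_left _ h1, fun ν => Finset.mem_union_right _
        (Finset.mem_image.2 ⟨(e.1, ν), Finset.mem_product.2 ⟨h1, Finset.mem_univ _⟩, rfl⟩)⟩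
    have hf : ∀ f : Fin Nf,
        |Real.log ‖fermionDet (wilsonDirac (fundamentalRep (Fin 3)) U' (μ f) 1)‖ -
            Real.log ‖fermionDet (wilsonDirac (fundamentalRep (Fin 3)) U (μ f) 1)‖| ≤
          Real.log (((60 * (2 * R + 1) ^ 4).factorial : ℝ) *
            (1 + 8 * lo⁻¹) ^ (60 * (2 * R + 1) ^ 4)) :=
      fun f => abs_log_det_sub_le T hTmem hlo (hμ f).1 hTcard
    have hne : ∀ (V : GaugeConfig 4 n SU3), ∀ f ∈ (Finset.univ : Finset (Fin Nf)),
        ‖fermionDet (wilsonDirac (fundamentalRep (Fin 3)) V (μ f) 1)‖ ≠ 0 := fun V f _ =>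
      norm_ne_zero_iff.2 (norm_inv_wilsonDirac_le V (hlo.trans_le (hμ f).1)).1
    rw [Real.log_prod (hne U'), Real.log_prod (hne U), ← Finset.sum_sub_distrib]
    refine (Finset.abs_sum_le_sum_abs _ _).trans ((Finset.sum_le_sum fun f _ => hf f).trans ?_)
    rw [Finset.sum_const, Finset.card_univ, Fintype.card_fin, nsmul_eq_mul]

end Summit.QuantumFields.QCD.Cruxes.WindowExtinction.FreeVolumeHeavyWitness

end
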